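import Literature.NumberTheory.LFunctions.WeilCriterionConverse
import Literature.NumberTheory.LFunctions.ZetaZeros
import Mathlib

/-!
# Stub `stub_fejerZeroProductOnLine` (plan T4', on-line terms are non-negative) for crux `WeilComb.CombShapePositivity`
(item stmt-RiemannHypothesis-11229, route route-RiemannHypothesis-WeilComb, line `Sketch`,
stub-plan `STUB-PLAN-stub_fejer`, tier T4' "zero-side product formula, on-line terms")

Notation: `φ_ε(t) = ε⁻¹ expNegInvGlue (1 − (t/ε)²)` (the route bump), `m(ρ)` the multiplicity of
the non-trivial zero `ρ` (`riemannZetaZeroOrder`), `P_g(ρ) = ĝ(ρ) conj ĝ(1 − ρ̄)`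
(`WeilConverse.pairCoeff`), `u_p = exp(iθ_p + (ρ − ½) log p)`.

**Statement (T4').** For every `ε`, finite `S ⊆ ℕ`, `n`, `θ` and every non-trivial zero `ρ`
ON the critical line `Re ρ = ½`, the `ρ`-term of the zero-side product formula
(`stub_fejerZeroProduct`),

  `m(ρ) P_{φ_ε}(ρ) ∏_{p∈S} (Σ_{j ≤ n} u_p^j)(Σ_{k ≤ n} u_p^{−k})`,

is a non-negative real number (`Re ≥ 0`, `Im = 0`): the transparent direction "RH ⇒ every Fejér
face is `≥ 0`".

**Proof.** On the line `1 − ρ̄ = ρ`, so `P_g(ρ) = ĝ(ρ) conj ĝ(ρ) = |ĝ(ρ)|²` (`Complex.mul_conj`).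
Also `ρ − ½ = iγ` is purely imaginary, so the exponent `iθ_p + (ρ − ½) log p` has real part `0`
and `u_p` is unimodular, `u_p⁻¹ = conj u_p` (`Complex.exp_conj`, `Complex.exp_neg`); hence
`Σ_k u_p^{−k} = conj Σ_j u_p^j` and each local factor is `|Σ_{j≤n} u_p^j|²`. Finally
`m(ρ) ≥ 0` for `ρ ≠ 1` (`riemannZetaZeroOrder_nonneg`), so the term is the real number
`m(ρ) |ĝ(ρ)|² ∏_p |Σ_j u_p^j|² ≥ 0` cast into `ℂ`.

Elementary bookkeeping (Mathlib + the definition of `pairCoeff`); a census instrument for the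
stub plan, not a step of the crux composition.
-/

noncomputable section

-- the sub-problem path RiemannHypothesis/RiemannHypothesis duplicates a namespace (D-0017)
set_option linter.dupNamespace false

open scoped BigOperators ComplexConjugate Real
open Complex

namespace Summit.RiemannHypothesis.RiemannHypothesis.Theorems.WeilCombBohrFejer

open Literature.NumberTheory.LFunctions
open Literature.NumberTheory.LFunctions.WeilConverse

/-! ## On the critical line -/

/-- On the critical line the functional-equation partner `1 − ρ̄` of `ρ` is `ρ` itself. [folklore] -/
theorem one_sub_conj_eq_self_of_re_eq_half {ρ : ℂ} (h : ρ.re = 1 / 2) : 1 - conj ρ = ρ := by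
  apply Complex.ext
  · simp only [Complex.sub_re, Complex.one_re, Complex.conj_re, h]
    norm_num
  · simp

/-- On the critical line the pair coefficient `P_g(ρ) = ĝ(ρ) conj ĝ(1 − ρ̄)` is the non-negative
real `|ĝ(ρ)|²`. [folklore] -/
theorem pairCoeff_eq_normSq_of_re_eq_half (g : ℝ → ℂ) {ρ : ℂ} (h : ρ.re = 1 / 2) :
    pairCoeff g ρ = ((Complex.normSq (weilMellin g ρ) : ℝ) : ℂ) := by
  rw [pairCoeff, one_sub_conj_eq_self_of_re_eq_half h, Complex.mul_conj]

/-- A complex exponential with purely imaginary exponent is unimodular: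
`(e^z)⁻¹ = conj (e^z)` for `Re z = 0`. [folklore] -/
theorem inv_exp_eq_conj_exp_of_re_eq_zero {z : ℂ} (hz : z.re = 0) :
    (Complex.exp z)⁻¹ = conj (Complex.exp z) := by
  rw [← Complex.exp_neg, ← Complex.exp_conj]
  congr 1
  apply Complex.ext
  · simp [hz]
  · simp

/-- The Fejér-type local factor: for `Re z = 0`,
`(Σ_{j≤n} (e^z)^j)(Σ_{k≤n} (e^z)^{−k}) = |Σ_{j≤n} (e^z)^j|²`. [folklore] -/
theorem geomFactor_eq_normSq {z : ℂ} (hz : z.re = 0) (n : ℕ) :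
    (∑ j ∈ Finset.range (n + 1), Complex.exp z ^ j) *
      (∑ k ∈ Finset.range (n + 1), (Complex.exp z)⁻¹ ^ k) =
    ((Complex.normSq (∑ j ∈ Finset.range (n + 1), Complex.exp z ^ j) : ℝ) : ℂ) := by
  rw [inv_exp_eq_conj_exp_of_re_eq_zero hz, ← Complex.mul_conj, map_sum]
  simp only [map_pow]

/-- On the critical line the Bohr exponent `iθ + (ρ − ½) log p` is purely imaginary. [folklore] -/
theorem re_bohrExponent_eq_zero {ρ : ℂ} (h : ρ.re = 1 / 2) (θ : ℝ) (p : ℕ) :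
    (I * (θ : ℂ) + (ρ - 1 / 2) * (Real.log (p : ℝ) : ℂ)).re = 0 := by
  simp only [Complex.add_re, Complex.mul_re, Complex.I_re, Complex.I_im, Complex.ofReal_re,
    Complex.ofReal_im, Complex.sub_re, h, zero_mul, mul_zero, sub_zero, zero_add]
  norm_num

/-- On the critical line the local product `∏_{p∈S} (Σ_{j≤n} u_p^j)(Σ_{k≤n} u_p^{−k})`,
`u_p = exp(iθ_p + (ρ − ½) log p)`, is the non-negative real `∏_{p∈S} |Σ_{j≤n} u_p^j|²`. [folklore] -/
theorem bohrProduct_eq_ofReal_of_re_eq_half {ρ : ℂ} (h : ρ.re = 1 / 2) (S : Finset ℕ) (n : ℕ)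
    (θ : ℕ → ℝ) :
    ∏ p ∈ S, ((∑ j ∈ Finset.range (n + 1),
        Complex.exp (I * (θ p : ℂ) + (ρ - 1 / 2) * (Real.log (p : ℝ) : ℂ)) ^ j) *
      (∑ k ∈ Finset.range (n + 1),
        (Complex.exp (I * (θ p : ℂ) + (ρ - 1 / 2) * (Real.log (p : ℝ) : ℂ)))⁻¹ ^ k)) =
    ((∏ p ∈ S, Complex.normSq (∑ j ∈ Finset.range (n + 1),
        Complex.exp (I * (θ p : ℂ) + (ρ - 1 / 2) * (Real.log (p : ℝ) : ℂ)) ^ j) : ℝ) : ℂ) := by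
  rw [Complex.ofReal_prod]
  exact Finset.prod_congr rfl fun p _ => geomFactor_eq_normSq (re_bohrExponent_eq_zero h (θ p) p) n

/-- A point on the critical line is not the pole `1`, so its multiplicity is `≥ 0`
(`riemannZetaZeroOrder_nonneg`). [folklore] -/
theorem riemannZetaZeroOrder_nonneg_of_re_eq_half {ρ : ℂ} (h : ρ.re = 1 / 2) :
    0 ≤ riemannZetaZeroOrder ρ := by
  refine riemannZetaZeroOrder_nonneg fun h1 => ?_
  rw [h1, Complex.one_re] at h
  norm_num at h

/-! ## The stub -/

/-- **Stub `stub_fejerZeroProductOnLine` (plan T4').** For a non-trivial zero `ρ` on the critical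
line, the `ρ`-term `m(ρ) P_{φ_ε}(ρ) ∏_{p∈S} (Σ_{j≤n} u_p^j)(Σ_{k≤n} u_p^{−k})` of the zero-side
product formula for the Fejér face is a non-negative real: its real part is `≥ 0` and its
imaginary part vanishes (it equals `m(ρ) |φ̂_ε(ρ)|² ∏_p |Σ_{j≤n} u_p^j|²`). [folklore] -/
theorem stub_fejerZeroProductOnLine : ∀ (ε : ℝ) (S : Finset ℕ) (n : ℕ) (θ : ℕ → ℝ) (ρ : ℂ),
  ρ ∈ ZetaZeros.riemannZetaNontrivialZeros → ρ.re = 1 / 2 →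
    0 ≤ ((riemannZetaZeroOrder ρ : ℂ) *
        Literature.NumberTheory.LFunctions.WeilConverse.pairCoeff
          (fun t : ℝ => (ε : ℂ)⁻¹ * ((expNegInvGlue (1 - (t / ε) ^ 2) : ℝ) : ℂ)) ρ *
        ∏ p ∈ S, ((∑ j ∈ Finset.range (n + 1),
            Complex.exp (I * (θ p : ℂ) + (ρ - 1 / 2) * (Real.log (p : ℝ) : ℂ)) ^ j) *
          (∑ k ∈ Finset.range (n + 1),
            (Complex.exp (I * (θ p : ℂ) + (ρ - 1 / 2) * (Real.log (p : ℝ) : ℂ)))⁻¹ ^ k))).re ∧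
    ((riemannZetaZeroOrder ρ : ℂ) *
        Literature.NumberTheory.LFunctions.WeilConverse.pairCoeff
          (fun t : ℝ => (ε : ℂ)⁻¹ * ((expNegInvGlue (1 - (t / ε) ^ 2) : ℝ) : ℂ)) ρ *
        ∏ p ∈ S, ((∑ j ∈ Finset.range (n + 1),
            Complex.exp (I * (θ p : ℂ) + (ρ - 1 / 2) * (Real.log (p : ℝ) : ℂ)) ^ j) *
          (∑ k ∈ Finset.range (n + 1),
            (Complex.exp (I * (θ p : ℂ) + (ρ - 1 / 2) * (Real.log (p : ℝ) : ℂ)))⁻¹ ^ k))).im = 0 := by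
  intro ε S n θ ρ _ hρ
  rw [bohrProduct_eq_ofReal_of_re_eq_half hρ S n θ, pairCoeff_eq_normSq_of_re_eq_half _ hρ,
    ← Complex.ofReal_intCast, ← Complex.ofReal_mul, ← Complex.ofReal_mul, Complex.ofReal_re,
    Complex.ofReal_im]
  refine ⟨mul_nonneg (mul_nonneg ?_ (Complex.normSq_nonneg _))
    (Finset.prod_nonneg fun _ _ => Complex.normSq_nonneg _), rfl⟩
  exact_mod_cast riemannZetaZeroOrder_nonneg_of_re_eq_half hρ

/-- Curried form of `stub_fejerZeroProductOnLine`, real part: on the line each `ρ`-term has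
non-negative real part. [folklore] -/
theorem fejerZeroProductOnLine_re_nonneg (ε : ℝ) (S : Finset ℕ) (n : ℕ) (θ : ℕ → ℝ) {ρ : ℂ}
    (hmem : ρ ∈ ZetaZeros.riemannZetaNontrivialZeros) (hρ : ρ.re = 1 / 2) :
    0 ≤ ((riemannZetaZeroOrder ρ : ℂ) *
        pairCoeff (fun t : ℝ => (ε : ℂ)⁻¹ * ((expNegInvGlue (1 - (t / ε) ^ 2) : ℝ) : ℂ)) ρ *
        ∏ p ∈ S, ((∑ j ∈ Finset.range (n + 1),
            Complex.exp (I * (θ p : ℂ) + (ρ - 1 / 2) * (Real.log (p : ℝ) : ℂ)) ^ j) *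
          (∑ k ∈ Finset.range (n + 1),
            (Complex.exp (I * (θ p : ℂ) + (ρ - 1 / 2) * (Real.log (p : ℝ) : ℂ)))⁻¹ ^ k))).re :=
  (stub_fejerZeroProductOnLine ε S n θ ρ hmem hρ).1

/-- Curried form of `stub_fejerZeroProductOnLine`, imaginary part: on the line each `ρ`-term is
real. [folklore] -/
theorem fejerZeroProductOnLine_im_eq_zero (ε : ℝ) (S : Finset ℕ) (n : ℕ) (θ : ℕ → ℝ) {ρ : ℂ}
    (hmem : ρ ∈ ZetaZeros.riemannZetaNontrivialZeros) (hρ : ρ.re = 1 / 2) :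
    ((riemannZetaZeroOrder ρ : ℂ) *
        pairCoeff (fun t : ℝ => (ε : ℂ)⁻¹ * ((expNegInvGlue (1 - (t / ε) ^ 2) : ℝ) : ℂ)) ρ *
        ∏ p ∈ S, ((∑ j ∈ Finset.range (n + 1),
            Complex.exp (I * (θ p : ℂ) + (ρ - 1 / 2) * (Real.log (p : ℝ) : ℂ)) ^ j) *
          (∑ k ∈ Finset.range (n + 1),
            (Complex.exp (I * (θ p : ℂ) + (ρ - 1 / 2) * (Real.log (p : ℝ) : ℂ)))⁻¹ ^ k))).im = 0 :=
  (stub_fejerZeroProductOnLine ε S n θ ρ hmem hρ).2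

end Summit.RiemannHypothesis.RiemannHypothesis.Theorems.WeilCombBohrFejer

end
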